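import Literature.NumberTheory.GaloisRepresentations.ContinuousH2
import Mathlib.Topology.Algebra.Group.Quotient
import Mathlib.GroupTheory.OrderOfElement
import HarnessLib

/-!
# Continuous `2`-cocycles inflated from a cyclic quotient: an explicit coboundary

Topic `NumberTheory/GaloisRepresentations`; namespace `Literature.NumberTheory.GaloisRepresentations`.
Definitions with bodies and theorems only: **no named fact is introduced** (D-0026).

Let `G` be a topological group, `X` a topological representation of `G` (Mathlib `TopRep`),
`H ≤ G` an OPEN normal subgroup acting trivially on `X`, and `F ∈ G` an element whose image
generates the quotient `G ⧸ H` (every coset is `Fⁱ H`).  Let `z ∈ Z²_cont(G, X)` be a continuous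
inhomogeneous `2`-cocycle (`contTwoCocycles`, file `ContinuousH2`) which is right-`H`-invariant in
each argument (so that it is "inflated" from the cyclic group `G ⧸ H = ⟨F̄⟩`).  Writing
`S(i) = ∑_{l<i} z(Fˡ, F)` ("partial norm sums", `frobSum`), the cocycle identity at `(Fⁱ, Fˡ, F)`
telescopes to

  `z(Fⁱ, Fʲ) = Fⁱ z(1,1) + S(i+j) - S(i) - Fⁱ S(j)`      (`apply_pow_pow`),

and `l ↦ z(Fˡ, F)` is periodic modulo any `p` with `Fᵖ ∈ H`, so `S(i+p) = S(i) + S(p)`.  Hence, **if the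
norm sum over one period of `F̄` vanishes, `S(orderOf F̄) = 0`**, then `S` depends only on `i mod
orderOf F̄`, the cochain `b(σ) = z(1,1) - S(idx σ)` (`idx σ` any exponent with `σ ∈ F^{idx σ} H`) is
well defined and continuous (it factors through the discrete quotient `G ⧸ H`), and

  `z(σ, τ) = σ b(τ) - b(στ) + b(σ)`      (`exists_eq_dOne_of_cyclicQuotient`),

i.e. `[z] = 0` in `H²_cont(G, X)` (`twoCocycleClass_eq_zero_of_cyclicQuotient`).  This is the cochain
form of the classical computation `H²(ℤ/n, A) ≅ A^{ℤ/n} / N·A` (the class of `z` is the norm-sum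
class `S(n)`) together with the fact that INFLATION along `ℤ/nk → ℤ/n` multiplies the norm-sum
class by `k` (`frobSum_mul_eq_smul`): for coefficients killed by `N` and `N ∣ k` the inflated class
dies (`frobSum_eq_zero_of_dvd`).  It is the finite-level content of `cd(Ẑ) ≤ 1`
("`H²(Ẑ, A) = lim→ A^G/N_n A = 0` for torsion `A`"), used in the tree to show that the local terms
of the Cassels–Tate pairing vanish at the unramified places (`EllipticCurves/LocalUnramifiedTwoCocycle`,
`EllipticCurves/CasselsTateFiniteSupport`).

## References

* [SerreGaloisCohomology1997] J.-P. Serre, *Galois Cohomology* (1997), Ch. I §2.2–2.3 (continuous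
  cochains, inflation), Ch. XIII of *Local Fields* §1 (cohomology of finite cyclic groups:
  `H²(G, A) = A^G/NA`).
* [NeukirchSchmidtWingberg2008] J. Neukirch, A. Schmidt, K. Wingberg, *Cohomology of Number Fields*,
  2nd ed. (2008), Ch. I §7 (cohomology of cyclic groups, (1.7.1)), Ch. I §6 (inflation).
* [MilneADT2006] J. S. Milne, *Arithmetic Duality Theorems*, 2nd ed. (2006), Ch. I §6, proof of
  Prop. 6.9 (the sum defining the Cassels–Tate pairing is finite: the cochains are `G_S`-cochains).

## Design

Everything is stated for an arbitrary `TopRep` `X` of a topological group `G` over a topological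
commutative ring `R`, an arbitrary subgroup `H` (normality and openness only where needed) and an
arbitrary `F`; the "order" of `F̄` is Mathlib's `orderOf` in `G ⧸ H` (the statements remain true, if
vacuous, when it is `0`).  `noncomputable section`, one universe pair as in `ContinuousH2`.
-/

noncomputable section

open scoped Classical

namespace Literature.NumberTheory.GaloisRepresentations

universe u v

variable {R : Type u} [CommRing R] [TopologicalSpace R]
variable {G : Type v} [Group G] [TopologicalSpace G] [IsTopologicalGroup G]
variable {X : TopRep.{v} R G}

/-! ## Partial norm sums `S(i) = ∑_{l<i} z(Fˡ, F)` and the telescoped cocycle identity -/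

section FrobSum

variable (z : contTwoCocycles X) (F : G)

/-- **The partial norm sums** `S(i) = ∑_{l < i} z(Fˡ, F) ∈ X` of a `2`-cocycle `z` along the powers
of `F` (for `i = orderOf F̄` this is the "norm" representing the class of `z` in
`H²(⟨F̄⟩, X) ≅ X^{F̄}/N X`). [cite: NeukirchSchmidtWingberg2008, Ch. I §7, Prop. (1.7.1)] -/
def frobSum (i : ℕ) : X :=
  ∑ l ∈ Finset.range i, z.1 (F ^ l, F)

omit [IsTopologicalGroup G] in
/-- `S(0) = 0`. [folklore] -/
@[simp]
theorem frobSum_zero : frobSum z F 0 = 0 := by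
  simp [frobSum]

omit [IsTopologicalGroup G] in
/-- `S(i+1) = S(i) + z(Fⁱ, F)`. [folklore] -/
theorem frobSum_succ (i : ℕ) : frobSum z F (i + 1) = frobSum z F i + z.1 (F ^ i, F) := by
  rw [frobSum, Finset.sum_range_succ, frobSum]

omit [IsTopologicalGroup G] in
/-- **The telescoped cocycle identity**: `z(Fⁱ, Fʲ) = Fⁱ z(1,1) + S(i+j) - S(i) - Fⁱ S(j)`.
Induction on `j`: the `2`-cocycle identity at `(Fⁱ, Fʲ, F)` reads
`Fⁱ z(Fʲ, F) + z(Fⁱ, Fʲ⁺¹) = z(Fⁱ⁺ʲ, F) + z(Fⁱ, Fʲ)`, and `z(Fⁱ, 1) = Fⁱ z(1, 1)`.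
[cite: NeukirchSchmidtWingberg2008, Ch. I §7, Prop. (1.7.1)] -/
theorem apply_pow_pow (i j : ℕ) :
    z.1 (F ^ i, F ^ j) =
      X.ρ (F ^ i) (z.1 (1, 1)) + frobSum z F (i + j) - frobSum z F i - X.ρ (F ^ i) (frobSum z F j) := by
  induction j with
  | zero =>
    rw [pow_zero, contTwoCocycles.apply_one_right z (F ^ i), add_zero, frobSum_zero, map_zero, sub_zero,
      add_sub_cancel_right]
  | succ j ih =>
    have hcoc := (mem_contTwoCocycles_iff z.1).mp z.2 (F ^ i) (F ^ j) F
    rw [← pow_succ, ← pow_add] at hcoc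
    -- `z(Fⁱ, Fʲ⁺¹) = z(Fⁱ⁺ʲ, F) + z(Fⁱ, Fʲ) - Fⁱ z(Fʲ, F)`
    have h1 : z.1 (F ^ i, F ^ (j + 1)) = z.1 (F ^ (i + j), F) + z.1 (F ^ i, F ^ j) - X.ρ (F ^ i) (z.1 (F ^ j, F)) := by
      rw [← hcoc]; abel
    rw [h1, ih, ← add_assoc, frobSum_succ, frobSum_succ, map_add]
    abel

variable {z F}

omit [IsTopologicalGroup G] in
/-- **Periodicity of `l ↦ z(Fˡ, F)`**: if `z` is right-invariant in its first argument under a subgroup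
`H` containing `Fᵖ`, then `z(Fˡ⁺ᵖ, F) = z(Fˡ, F)`. [folklore] -/
theorem apply_pow_add_period {H : Subgroup G} (hz₁ : ∀ σ τ : G, ∀ h ∈ H, z.1 (σ * h, τ) = z.1 (σ, τ))
    {p : ℕ} (hp : F ^ p ∈ H) (l : ℕ) : z.1 (F ^ (l + p), F) = z.1 (F ^ l, F) := by
  rw [pow_add, hz₁ _ _ _ hp]

omit [IsTopologicalGroup G] in
/-- A window sum of a `p`-periodic sequence does not depend on the window. [folklore] -/
theorem sum_range_add_eq_of_periodic {M : Type*} [AddCommGroup M] (g : ℕ → M) (p : ℕ)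
    (hg : ∀ l, g (l + p) = g l) (i : ℕ) :
    ∑ l ∈ Finset.range p, g (i + l) = ∑ l ∈ Finset.range p, g l := by
  induction i with
  | zero => simp
  | succ i ih =>
    -- compute `∑_{l < p+1} g(i+l)` in two ways
    have h1 : ∑ l ∈ Finset.range (p + 1), g (i + l) = ∑ l ∈ Finset.range p, g (i + l) + g (i + p) :=
      Finset.sum_range_succ _ _
    have h2 : ∑ l ∈ Finset.range (p + 1), g (i + l) = ∑ l ∈ Finset.range p, g (i + (l + 1)) + g (i + 0) :=
      Finset.sum_range_succ' _ _
    rw [add_zero] at h2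
    rw [hg i, h2] at h1
    have h3 : ∑ l ∈ Finset.range p, g (i + (l + 1)) = ∑ l ∈ Finset.range p, g (i + l) := add_right_cancel h1
    rw [← ih, ← h3]
    refine Finset.sum_congr rfl fun l _ => ?_
    rw [Nat.succ_add, Nat.add_succ]

omit [IsTopologicalGroup G] in
/-- **`S(i + p) = S(i) + S(p)`** for a period `p` (`Fᵖ ∈ H`, `z` right-`H`-invariant in the first
argument). [cite: NeukirchSchmidtWingberg2008, Ch. I §7, Prop. (1.7.1)] -/
theorem frobSum_add_period {H : Subgroup G} (hz₁ : ∀ σ τ : G, ∀ h ∈ H, z.1 (σ * h, τ) = z.1 (σ, τ))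
    {p : ℕ} (hp : F ^ p ∈ H) (i : ℕ) : frobSum z F (i + p) = frobSum z F i + frobSum z F p := by
  unfold frobSum
  rw [Finset.sum_range_add]
  congr 1
  exact sum_range_add_eq_of_periodic (fun l => z.1 (F ^ l, F)) p (apply_pow_add_period hz₁ hp) i

omit [IsTopologicalGroup G] in
/-- **Inflation multiplies the norm sum by the index**: `S(p k) = k • S(p)` for a period `p`.
[cite: NeukirchSchmidtWingberg2008, Ch. I §7, Prop. (1.7.1)] -/
theorem frobSum_mul_eq_smul {H : Subgroup G} (hz₁ : ∀ σ τ : G, ∀ h ∈ H, z.1 (σ * h, τ) = z.1 (σ, τ))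
    {p : ℕ} (hp : F ^ p ∈ H) (k : ℕ) : frobSum z F (p * k) = k • frobSum z F p := by
  induction k with
  | zero => rw [mul_zero, frobSum_zero, zero_smul]
  | succ k ih => rw [Nat.mul_succ, frobSum_add_period hz₁ hp, ih, succ_nsmul]

omit [IsTopologicalGroup G] in
/-- **The inflated norm sum dies on coefficients killed by a divisor of the index**: if `Fᵖ ∈ H₀`,
`z` is right-`H₀`-invariant in its first argument, `N • x = 0` on `X` and `N ∣ k`, then `S(p k) = 0`.
This is the vanishing of `inf : H²(ℤ/p, A) → H²(ℤ/pk, A)` on `N`-torsion coefficients when `N ∣ k`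
("`cd Ẑ ≤ 1`" at finite level). [cite: NeukirchSchmidtWingberg2008, Ch. I §7, Prop. (1.7.1)] -/
theorem frobSum_eq_zero_of_dvd {H₀ : Subgroup G} (hz₀ : ∀ σ τ : G, ∀ h ∈ H₀, z.1 (σ * h, τ) = z.1 (σ, τ))
    {p : ℕ} (hp : F ^ p ∈ H₀) {N k : ℕ} (hNX : ∀ x : X, N • x = 0) (hNk : N ∣ k) :
    frobSum z F (p * k) = 0 := by
  obtain ⟨t, rfl⟩ := hNk
  rw [frobSum_mul_eq_smul hz₀ hp, mul_comm, mul_nsmul, hNX]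

omit [IsTopologicalGroup G] in
/-- `S(i + p t) = S(i)` when the norm sum over the period vanishes, `S(p) = 0`. [folklore] -/
theorem frobSum_add_mul_of_eq_zero {H : Subgroup G} (hz₁ : ∀ σ τ : G, ∀ h ∈ H, z.1 (σ * h, τ) = z.1 (σ, τ))
    {p : ℕ} (hp : F ^ p ∈ H) (hsum : frobSum z F p = 0) (i t : ℕ) :
    frobSum z F (i + p * t) = frobSum z F i := by
  induction t with
  | zero => rw [mul_zero, add_zero]
  | succ t ih => rw [Nat.mul_succ, ← add_assoc, frobSum_add_period hz₁ hp, ih, hsum, add_zero]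

omit [IsTopologicalGroup G] in
/-- `S(i) = S(i mod p)` when `S(p) = 0`. [folklore] -/
theorem frobSum_eq_frobSum_mod {H : Subgroup G} (hz₁ : ∀ σ τ : G, ∀ h ∈ H, z.1 (σ * h, τ) = z.1 (σ, τ))
    {p : ℕ} (hp : F ^ p ∈ H) (hsum : frobSum z F p = 0) (i : ℕ) :
    frobSum z F i = frobSum z F (i % p) := by
  conv_lhs => rw [← Nat.mod_add_div i p]
  exact frobSum_add_mul_of_eq_zero hz₁ hp hsum (i % p) (i / p)

omit [IsTopologicalGroup G] in
/-- `S(i) = S(j)` for `i ≡ j (mod p)` when `S(p) = 0`. [folklore] -/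
theorem frobSum_eq_of_modEq {H : Subgroup G} (hz₁ : ∀ σ τ : G, ∀ h ∈ H, z.1 (σ * h, τ) = z.1 (σ, τ))
    {p : ℕ} (hp : F ^ p ∈ H) (hsum : frobSum z F p = 0) {i j : ℕ} (hij : i ≡ j [MOD p]) :
    frobSum z F i = frobSum z F j := by
  rw [frobSum_eq_frobSum_mod hz₁ hp hsum i, frobSum_eq_frobSum_mod hz₁ hp hsum j, hij]

end FrobSum

/-! ## The coboundary of a cocycle inflated from a cyclic quotient -/

section Cyclic

variable (H : Subgroup G) [H.Normal] (F : G) (z : contTwoCocycles X)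
variable (hgen : ∀ q : G ⧸ H, ∃ i : ℕ, q = (QuotientGroup.mk F : G ⧸ H) ^ i)

/-- An exponent `i` with `q = F̄ⁱ` in the cyclic quotient `G ⧸ H = ⟨F̄⟩` (a choice). [folklore] -/
def idxQ (q : G ⧸ H) : ℕ :=
  Classical.choose (hgen q)

omit [TopologicalSpace G] [IsTopologicalGroup G] in
/-- `q = F̄ ^ idxQ q`. [folklore] -/
theorem idxQ_spec (q : G ⧸ H) : q = (QuotientGroup.mk F : G ⧸ H) ^ idxQ H F hgen q :=
  Classical.choose_spec (hgen q)

omit [TopologicalSpace G] [IsTopologicalGroup G] in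
/-- Every `σ` is `F ^ idx σ` times an element of `H`. [folklore] -/
theorem pow_idxQ_inv_mul_mem (σ : G) : (F ^ idxQ H F hgen (σ : G ⧸ H))⁻¹ * σ ∈ H := by
  rw [← QuotientGroup.eq, QuotientGroup.mk_pow]
  exact (idxQ_spec H F hgen (σ : G ⧸ H)).symm

omit [TopologicalSpace G] [IsTopologicalGroup G] in
/-- The exponents are additive modulo the order of `F̄`: `idx(στ) ≡ idx σ + idx τ (mod orderOf F̄)`. [folklore] -/
theorem idxQ_mul_modEq (σ τ : G) :
    idxQ H F hgen ((σ * τ : G) : G ⧸ H) ≡ idxQ H F hgen (σ : G ⧸ H) + idxQ H F hgen (τ : G ⧸ H)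
      [MOD orderOf (QuotientGroup.mk F : G ⧸ H)] := by
  rw [← pow_eq_pow_iff_modEq, pow_add, ← idxQ_spec H F hgen, ← idxQ_spec H F hgen, ← idxQ_spec H F hgen,
    QuotientGroup.mk_mul]

/-- **The cochain `b(σ) = z(1,1) - S(idx σ)`** (a function of the coset `σ H`).
[cite: NeukirchSchmidtWingberg2008, Ch. I §7, Prop. (1.7.1)] -/
def cyclicCochainFun (σ : G) : X :=
  z.1 (1, 1) - frobSum z F (idxQ H F hgen (σ : G ⧸ H))

/-- `b` is continuous when `H` is open: it factors through the discrete quotient `G ⧸ H`. [folklore] -/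
theorem continuous_cyclicCochainFun (hopen : IsOpen (H : Set G)) : Continuous (cyclicCochainFun H F z hgen) := by
  haveI : DiscreteTopology (G ⧸ H) := QuotientGroup.discreteTopology hopen
  have hc : Continuous (fun q : G ⧸ H => z.1 (1, 1) - frobSum z F (idxQ H F hgen q)) :=
    continuous_of_discreteTopology
  exact hc.comp QuotientGroup.continuous_mk

/-- The cochain `b` as a continuous `1`-cochain (for `H` open). [cite: NeukirchSchmidtWingberg2008, Ch. I §7, Prop. (1.7.1)] -/
def cyclicCochain (hopen : IsOpen (H : Set G)) : C(G, X) :=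
  ⟨cyclicCochainFun H F z hgen, continuous_cyclicCochainFun H F z hgen hopen⟩

/-- Unfolding `cyclicCochain`. [folklore] -/
@[simp]
theorem cyclicCochain_apply (hopen : IsOpen (H : Set G)) (σ : G) :
    cyclicCochain H F z hgen hopen σ = z.1 (1, 1) - frobSum z F (idxQ H F hgen (σ : G ⧸ H)) :=
  rfl

/-- **A `2`-cocycle inflated from a cyclic quotient whose norm sum vanishes is a coboundary.**  Let
`H ≤ G` be an open normal subgroup acting trivially on `X`, `F ∈ G` with `G ⧸ H = ⟨F̄⟩`, and `z` a
continuous `2`-cocycle right-`H`-invariant in both arguments with `∑_{l < orderOf F̄} z(Fˡ, F) = 0`.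
Then `z(σ, τ) = σ b(τ) - b(στ) + b(σ)` for the continuous cochain `b = cyclicCochain`.  Proof: write
`σ = Fⁱ h`, `τ = Fʲ h'`; by invariance `z(σ, τ) = z(Fⁱ, Fʲ)` and `σ` acts as `Fⁱ`; `idx(στ) ≡ i + j`
and `S` is periodic, so the right-hand side is `Fⁱ z(1,1) - Fⁱ S(j) + S(i+j) - S(i)`, which is
`z(Fⁱ, Fʲ)` by the telescoped cocycle identity `apply_pow_pow`.
[cite: NeukirchSchmidtWingberg2008, Ch. I §7, Prop. (1.7.1); Ch. I §6 (inflation)] -/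
theorem eq_dOne_cyclicCochain (hopen : IsOpen (H : Set G))
    (hz₁ : ∀ σ τ : G, ∀ h ∈ H, z.1 (σ * h, τ) = z.1 (σ, τ))
    (hz₂ : ∀ σ τ : G, ∀ h ∈ H, z.1 (σ, τ * h) = z.1 (σ, τ))
    (hHX : ∀ h ∈ H, ∀ x : X, X.ρ h x = x)
    (hsum : frobSum z F (orderOf (QuotientGroup.mk F : G ⧸ H)) = 0) (σ τ : G) :
    z.1 (σ, τ) = X.ρ σ (cyclicCochain H F z hgen hopen τ) - cyclicCochain H F z hgen hopen (σ * τ) +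
      cyclicCochain H F z hgen hopen σ := by
  set i := idxQ H F hgen (σ : G ⧸ H) with hi
  set j := idxQ H F hgen (τ : G ⧸ H) with hj
  set k := idxQ H F hgen ((σ * τ : G) : G ⧸ H) with hk
  set h := (F ^ i)⁻¹ * σ with hh
  set h' := (F ^ j)⁻¹ * τ with hh'
  have hhH : h ∈ H := pow_idxQ_inv_mul_mem H F hgen σ
  have hh'H : h' ∈ H := pow_idxQ_inv_mul_mem H F hgen τ
  have hσ : σ = F ^ i * h := by rw [hh, mul_inv_cancel_left]
  have hτ : τ = F ^ j * h' := by rw [hh', mul_inv_cancel_left]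
  -- the period
  have hp : F ^ orderOf (QuotientGroup.mk F : G ⧸ H) ∈ H := by
    rw [← QuotientGroup.eq_one_iff, QuotientGroup.mk_pow, pow_orderOf_eq_one]
  -- `z(σ, τ) = z(Fⁱ, Fʲ)`
  have hzij : z.1 (σ, τ) = z.1 (F ^ i, F ^ j) := by
    rw [hσ, hz₁ _ _ _ hhH, hτ, hz₂ _ _ _ hh'H]
  -- `σ` acts as `Fⁱ`
  have hρ : ∀ x : X, X.ρ σ x = X.ρ (F ^ i) x := fun x => by
    rw [hσ, map_mul]
    change X.ρ (F ^ i) (X.ρ h x) = _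
    rw [hHX h hhH]
  -- `S(k) = S(i + j)`
  have hSk : frobSum z F k = frobSum z F (i + j) :=
    frobSum_eq_of_modEq hz₁ hp hsum (idxQ_mul_modEq H F hgen σ τ)
  rw [cyclicCochain_apply, cyclicCochain_apply, cyclicCochain_apply, ← hk, ← hi, ← hj, hSk, hρ, hzij,
    apply_pow_pow, map_sub]
  abel

include hgen in
/-- Existence form: such a `z` is the coboundary of a continuous `1`-cochain.
[cite: NeukirchSchmidtWingberg2008, Ch. I §7, Prop. (1.7.1)] -/
theorem exists_eq_dOne_of_cyclicQuotient (hopen : IsOpen (H : Set G))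
    (hz₁ : ∀ σ τ : G, ∀ h ∈ H, z.1 (σ * h, τ) = z.1 (σ, τ))
    (hz₂ : ∀ σ τ : G, ∀ h ∈ H, z.1 (σ, τ * h) = z.1 (σ, τ))
    (hHX : ∀ h ∈ H, ∀ x : X, X.ρ h x = x)
    (hsum : frobSum z F (orderOf (QuotientGroup.mk F : G ⧸ H)) = 0) :
    ∃ b : C(G, X), ∀ σ τ : G, z.1 (σ, τ) = X.ρ σ (b τ) - b (σ * τ) + b σ :=
  ⟨cyclicCochain H F z hgen hopen, eq_dOne_cyclicCochain H F z hgen hopen hz₁ hz₂ hHX hsum⟩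

include hgen in
/-- **Class form: `[z] = 0` in `H²_cont(G, X)`** for a continuous `2`-cocycle inflated from the cyclic
quotient `G ⧸ H = ⟨F̄⟩` (`H` open normal, acting trivially, `z` right-`H`-invariant in both arguments)
whose norm sum over one period of `F̄` vanishes.  With `frobSum_eq_zero_of_dvd` this is the vanishing
of classes inflated from `ℤ/p` to `ℤ/pk` on `N`-torsion coefficients, `N ∣ k`.
[cite: NeukirchSchmidtWingberg2008, Ch. I §7, Prop. (1.7.1); Ch. I §6] -/
theorem twoCocycleClass_eq_zero_of_cyclicQuotient [LocallyCompactSpace G] (hopen : IsOpen (H : Set G))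
    (hz₁ : ∀ σ τ : G, ∀ h ∈ H, z.1 (σ * h, τ) = z.1 (σ, τ))
    (hz₂ : ∀ σ τ : G, ∀ h ∈ H, z.1 (σ, τ * h) = z.1 (σ, τ))
    (hHX : ∀ h ∈ H, ∀ x : X, X.ρ h x = x)
    (hsum : frobSum z F (orderOf (QuotientGroup.mk F : G ⧸ H)) = 0) :
    twoCocycleClass X z = 0 :=
  (twoCocycleClass_eq_zero_iff X z).mpr (exists_eq_dOne_of_cyclicQuotient H F z hgen hopen hz₁ hz₂ hHX hsum)

end Cyclic

end Literature.NumberTheory.GaloisRepresentations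

end
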